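import Mathlib
import Summits.CriticalPhenomena.CardyFormulaZ2.Theorems.CardySelfRefinementDefs
import Literature.Probability.Percolation.QuadCrossingQuadTopology
import Literature.Probability.Percolation.QuadCrossingRotationInvariance
import Literature.Probability.Percolation.CellBoundary
import Literature.Probability.LatticeModels.MeshColumns
import Literature.Probability.LatticeModels.WeakBeurlingEstimate
import Literature.Topology.PlaneTopology.JordanLoopSides
import HarnessLib

/-!
# Boundary-layer surgery, topology brick (S1): the free-cell / bridge dichotomy

Helper file of the registered stub `stub_layerLocalModification` (the deterministic
boundary-layer surgery) of the line `monotone-product-coordinates` (crux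
`stmt-CriticalPhenomena-10269`, `…Theses.CardySelfRefinement.GradientComparability`).  The layer
surgery classifies an axial lattice edge `e = {u, u'}` drawn (at mesh `δ`) inside the CLOSED
carrier `[Q]` of a quad `Q` by the room it has inside `[Q]`.  This file proves the first,
configuration-free alternative of that classification:

* **`quadCarrier_cell_or_bridge`** (registered helper): EITHER one of the two closed unit
  mesh cells beside `e` lies in `[Q]` (room of one cell on one side: the three other sides of
  that cell are a detour of `e` drawn in `[Q]`), OR `e` is a **bridge** of the graph of lattice
  edges drawn inside `[Q]`: every lattice walk from `u` to `u'` whose drawn edges lie in `[Q]`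
  uses the edge `{u, u'}`.

Proof.  A detour of `e` drawn in `[Q]`, taken simple (`Walk.bypass`) and closed up by `e`, is
a simple lattice cycle with at least three sites; its drawing is a simple closed polygon
(`isSimpleClosedPolygon_latticeCycle`, via `CellComplex.icoSegment_cases`), i.e. a Jordan loop
`γ` (`polygonLoop`) running in `[Q]` on the grid lines of `δℤ²`.  As `[Q]` is the image of the
closed square under a plane homeomorphism (`Quad.exists_straighten`), the closed inside of `γ`
lies in `[Q]` (`closure_inside_subset_carrier`); and an open box around the midpoint of `e`
meets the complement of `γ` only inside the two open mesh cells beside `e`, so one of them is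
inside `γ` (`IsJordanLoop.subset_inside_or_of_nhds`; `exists_cell_subset_inside`).  No
percolation, no named fact.
-/

noncomputable section

namespace Summit.CriticalPhenomena.CardyFormulaZ2.Theorems.CardySelfRefinement

open scoped Topology
open Filter Set MeasureTheory
open Literature.Probability.LatticeModels Literature.Probability.Percolation
open Literature.Probability.Percolation.QuadCrossing
open Summit.CriticalPhenomena.CardyFormulaZ2.Theses.CardySelfRefinement
open Literature.Topology.PlaneTopology Literature.Probability.RandomPlanarGeometry

variable {D : Set ℂ} {δ : ℝ}

/-! ## Simple lattice cycles drawn at mesh `δ` are Jordan loops -/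

/-- Half-open drawn lattice segments at mesh `δ` are the `δ`-multiples of those at mesh `1`. -/
theorem icoSegment_meshPoint (δ : ℝ) (x y : Site 2) :
    icoSegment (meshPoint δ x) (meshPoint δ y) =
      (fun z : ℂ => (δ : ℂ) * z) '' icoSegment (Site.toComplex x) (Site.toComplex y) := by
  rw [icoSegment, icoSegment, Set.image_image]
  refine Set.image_congr fun θ _ => ?_
  simp only [AffineMap.lineMap_apply_module, meshPoint, Complex.real_smul]
  ring

/-- **A simple lattice cycle drawn at mesh `δ > 0` is a simple closed polygon**: for `N ≥ 3`
cyclically adjacent, pairwise distinct sites `V 0, …, V (N - 1)` of `ℤ²`, the drawn half-open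
edges are pairwise disjoint (`IsSimpleClosedPolygon`; two overlapping half-open lattice edges
start at the same site or are the two orientations of one edge, `CellComplex.icoSegment_cases`,
and a back-and-forth needs `N = 2`). -/
theorem isSimpleClosedPolygon_latticeCycle (hδ : 0 < δ) {N : ℕ} {V : ℕ → Site 2}
    (hN : 3 ≤ N) (hadj : ∀ i < N, (zdGraph 2).Adj (V i) (V ((i + 1) % N)))
    (hinj : Set.InjOn V (Set.Iio N)) :
    IsSimpleClosedPolygon ((List.range N).map fun i => meshPoint δ (V i)) := by
  set l := (List.range N).map fun i => meshPoint δ (V i) with hl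
  have hlen : l.length = N := by simp [hl]
  have hget : ∀ (i : ℕ) (hi : i < l.length), l[i] = meshPoint δ (V i) := fun i hi => by
    simp [hl]
  have hδ' : (δ : ℂ) ≠ 0 := Complex.ofReal_ne_zero.2 hδ.ne'
  refine IsSimpleClosedPolygon.of_lt (by rw [hlen]; omega) (fun k hk => ?_)
    (fun i j hi hj hij => ?_)
  · rw [hget, hget]
    simp only [hlen]
    exact fun h => (hadj k (hlen ▸ hk)).ne (DiscreteDobrushin.meshPoint_injective hδ.ne' h)
  · have hi' : i < N := hlen ▸ hi
    have hj' : j < N := hlen ▸ hj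
    obtain ⟨k, hk⟩ := WeakBeurling.exists_eq_add_cornerUnit_of_adj (hadj i hi')
    obtain ⟨k', hk'⟩ := WeakBeurling.exists_eq_add_cornerUnit_of_adj (hadj j hj')
    rw [hget, hget, hget, hget]
    simp only [hlen]
    rw [hk, hk', icoSegment_meshPoint, icoSegment_meshPoint,
      Set.disjoint_image_iff (mul_right_injective₀ hδ'), Set.disjoint_left]
    intro p hp hp'
    have hmod : (i + 1) % N = i + 1 := Nat.mod_eq_of_lt (by omega)
    -- `i + 2 ≢ i (mod N)` for `N ≥ 3`
    have hkey : (i + 1 + 1) % N ≠ i := by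
      intro h2
      rcases Nat.lt_or_ge (i + 1 + 1) N with hlt | hge
      · rw [Nat.mod_eq_of_lt hlt] at h2; omega
      · rw [Nat.mod_eq_sub_mod hge, Nat.mod_eq_of_lt (by omega)] at h2; omega
    rcases CellComplex.icoSegment_cases hp hp' with h | ⟨hv, hd⟩ | ⟨hv, hd⟩
    · exact absurd (hinj hi' hj' h) hij.ne
    · -- `V j = V (i + 1)` and `V (j + 1) = V i`: a back-and-forth
      have h1 : j = i + 1 := by
        rw [← hmod]; exact hinj hj' (Nat.mod_lt _ (by omega)) (hv.trans hk.symm)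
      subst h1
      refine hkey (hinj (Nat.mod_lt _ (by omega)) hi' ?_)
      rw [hk', hv, hd, cornerUnit_add_two, add_neg_cancel_right]
    · -- `V i = V (j + 1)` and `V (i + 1) = V j`: the same, reversed
      have h1 : i + 1 = j := by
        rw [← hmod]
        refine hinj (Nat.mod_lt _ (by omega)) hj' ?_
        rw [hk, hv, hd, cornerUnit_add_two, add_neg_cancel_right]
      subst h1
      exact hkey (hinj (Nat.mod_lt _ (by omega)) hi' (hk'.trans hv.symm))

/-- **The drawn simple lattice cycle as a Jordan loop**: for a cycle as in
`isSimpleClosedPolygon_latticeCycle` there is a Jordan loop whose range is the union of the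
drawn closed edges `[δ V i, δ V (i+1 mod N)]` (the closed polygon `polygonLoop`). -/
theorem exists_isJordanLoop_latticeCycle (hδ : 0 < δ) {N : ℕ} {V : ℕ → Site 2}
    (hN : 3 ≤ N) (hadj : ∀ i < N, (zdGraph 2).Adj (V i) (V ((i + 1) % N)))
    (hinj : Set.InjOn V (Set.Iio N)) :
    ∃ γ : ℝ → ℂ, IsJordanLoop γ ∧ ∀ z, z ∈ range γ ↔
      ∃ i < N, z ∈ segment ℝ (meshPoint δ (V i)) (meshPoint δ (V ((i + 1) % N))) := by
  set l := (List.range N).map fun i => meshPoint δ (V i) with hl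
  have hlen : l.length = N := by simp [hl]
  have hget : ∀ (i : ℕ) (hi : i < l.length), l[i] = meshPoint δ (V i) := fun i hi => by
    simp [hl]
  have hne : l ≠ [] := List.ne_nil_of_length_pos (by rw [hlen]; omega)
  refine ⟨polygonLoop l, ⟨continuous_polygonLoop l, periodic_polygonLoop l,
    injOn_polygonLoop (isSimpleClosedPolygon_latticeCycle hδ hN hadj hinj)⟩, fun z => ?_⟩
  rw [range_polygonLoop hne, Set.mem_iUnion]
  constructor
  · rintro ⟨⟨k, hk⟩, hz⟩
    rw [hget, hget] at hz; simp only [hlen] at hz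
    exact ⟨k, hlen ▸ hk, hz⟩
  · rintro ⟨k, hk, hz⟩
    refine ⟨⟨k, hlen.symm ▸ hk⟩, ?_⟩
    rw [hget, hget]; simp only [hlen]
    exact hz

/-- **The closed inside of a Jordan loop running in `[Q]` lies in `[Q]`.**  `[Q]` is the image
of the closed square `[-1,1]²` under a homeomorphism `H` of the plane (`Quad.exists_straighten`);
the loop `H⁻¹ ∘ γ` runs in this closed convex set, which therefore contains its inside
(`IsJordanLoop.inside_subset_interior_of_convex`), and plane homeomorphisms map insides to
insides (`IsJordanLoop.inside_comp_homeomorph`). -/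
theorem closure_inside_subset_carrier {γ : ℝ → ℂ} (hγ : IsJordanLoop γ) (Q : Quad D)
    (h : range γ ⊆ Q.carrier) : closure (IsJordanLoop.inside γ) ⊆ Q.carrier := by
  obtain ⟨H, -, hcar, -⟩ := Q.exists_straighten
  set S : Set ℂ := Icc (-1 : ℝ) 1 ×ℂ Icc (-1 : ℝ) 1 with hS
  have hSc : IsClosed S := isClosed_Icc.reProdIm isClosed_Icc
  have hSconv : Convex ℝ S := by
    rw [hS, ← (convex_Icc (𝕜 := ℝ) (-1 : ℝ) 1).convexHull_eq,
      ← Complex.convexHull_reProdIm]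
    exact convex_convexHull ℝ _
  set γ' : ℝ → ℂ := H.symm ∘ γ with hγ'
  have hJ' : IsJordanLoop γ' := hγ.comp_homeomorph H.symm
  have hrange' : range γ' ⊆ S := by
    rintro _ ⟨t, rfl⟩
    obtain ⟨w, hw, hwt⟩ : γ t ∈ H '' S := hcar ▸ h ⟨t, rfl⟩
    show H.symm (γ t) ∈ S
    rw [← hwt, Homeomorph.symm_apply_apply]
    exact hw
  have hins' : IsJordanLoop.inside γ' ⊆ S :=
    (hJ'.inside_subset_interior_of_convex hSconv hSc hrange').trans interior_subset
  have hcomp : (H : ℂ → ℂ) ∘ γ' = γ := funext fun t => by simp [hγ']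
  have hins : IsJordanLoop.inside γ ⊆ Q.carrier := by
    have key := hJ'.inside_comp_homeomorph H
    rw [hcomp] at key
    rw [key, hcar]
    exact Set.image_mono hins'
  exact closure_minimal hins Q.isCompact_carrier.isClosed

/-! ## A mesh cell beside an edge of a grid Jordan loop is inside -/

/-- **Local two-sidedness for mesh cells.**  If an open neighbourhood of a point of a Jordan
loop running on the grid lines of `δℤ²` meets the complement of the loop only inside two open
mesh cells, then one of the two cells lies inside the loop (the cells are convex and miss the
grid lines; `IsJordanLoop.subset_inside_or_of_nhds`). -/
theorem cell_subset_inside_or (hδ : 0 < δ) {γ : ℝ → ℂ} (hγ : IsJordanLoop γ)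
    (hgrid : range γ ⊆ Mesh.gridLines δ) {m : ℂ} (hm : m ∈ range γ) {V : Set ℂ}
    (hVo : IsOpen V) (hmV : m ∈ V) (a b a' b' : ℤ)
    (hVPP : V \ range γ ⊆ Mesh.cell δ a b ∪ Mesh.cell δ a' b') :
    Mesh.cell δ a b ⊆ IsJordanLoop.inside γ ∨
      Mesh.cell δ a' b' ⊆ IsJordanLoop.inside γ := by
  have hc : ∀ k j : ℤ, Mesh.cell δ k j ⊆ (range γ)ᶜ := fun k j z hz hzγ =>
    Mesh.cell_subset_compl_gridLines hδ k j hz (hgrid hzγ)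
  exact (hγ.subset_inside_or_of_nhds hm (hVo.mem_nhds hmV) hVPP
    (Mesh.convex_cell δ a b).isPreconnected (Mesh.convex_cell δ a' b').isPreconnected
    (hc a b) (hc a' b')).imp (fun h => h.1) fun h => h.2

/-- **A grid Jordan loop through a lattice edge has an adjacent cell inside.**  If a Jordan loop
runs on the grid lines of `δℤ²` (`δ > 0`) and contains the drawn edge from `u` to `u + eᵢ`,
then one of the two open mesh cells beside that edge (lower-left corner `c`; `u`, `u + eᵢ` are
corners of the cell) lies inside the loop: an open box around the midpoint of the edge meets
the complement of the loop only inside these two cells. -/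
theorem exists_cell_subset_inside (hδ : 0 < δ) {γ : ℝ → ℂ} (hγ : IsJordanLoop γ)
    (hgrid : range γ ⊆ Mesh.gridLines δ) (u : Site 2) (i : Fin 2)
    (hseg : segment ℝ (meshPoint δ u) (meshPoint δ (u + Pi.single i 1)) ⊆ range γ) :
    ∃ c : Site 2, (∀ k, u k = c k ∨ u k = c k + 1) ∧
      (∀ k, (u + Pi.single i 1 : Site 2) k = c k ∨ (u + Pi.single i 1 : Site 2) k = c k + 1) ∧
      Mesh.cell δ (c 0) (c 1) ⊆ IsJordanLoop.inside γ := by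
  have hi01 : i = 0 ∨ i = 1 := by fin_cases i <;> simp
  rcases hi01 with rfl | rfl
  · -- horizontal edge `u → u + e₀`: the cells `(u 0, u 1)` above and `(u 0, u 1 - 1)` below
    have h0 : (((u + Pi.single (0 : Fin 2) (1 : ℤ) : Site 2) 0 : ℤ) : ℝ) = u 0 + 1 := by simp
    have h1 : (((u + Pi.single (0 : Fin 2) (1 : ℤ) : Site 2) 1 : ℤ) : ℝ) = u 1 := by simp
    set m : ℂ := ⟨δ * (u 0 + 1 / 2), δ * u 1⟩ with hm
    have hmseg : m ∈ range γ := by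
      refine hseg ?_
      rw [segment_eq_image']
      refine ⟨1 / 2, ⟨by norm_num, by norm_num⟩, Complex.ext ?_ ?_⟩
      · simp only [Complex.add_re, Complex.smul_re, Complex.sub_re, meshPoint_re, h0,
          smul_eq_mul, hm]; ring
      · simp only [Complex.add_im, Complex.smul_im, Complex.sub_im, meshPoint_im, h1,
          smul_eq_mul, hm]; ring
    set W : Set ℂ := Ioo (δ * u 0) (δ * (u 0 + 1)) ×ℂ Ioo (δ * (u 1 - 1)) (δ * (u 1 + 1))
      with hW
    have hWo : IsOpen W := isOpen_Ioo.reProdIm isOpen_Ioo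
    have hmW : m ∈ W := by
      simp only [hW, Complex.mem_reProdIm, mem_Ioo, hm]
      refine ⟨⟨?_, ?_⟩, ?_, ?_⟩ <;> nlinarith
    have hWPP : W \ range γ ⊆ Mesh.cell δ (u 0) (u 1) ∪ Mesh.cell δ (u 0) (u 1 - 1) := by
      rintro z ⟨⟨hzre, hzim⟩, hzγ⟩
      simp only [mem_preimage, mem_Ioo] at hzre hzim
      rcases lt_trichotomy z.im (δ * u 1) with hlt | heq | hgt
      · right
        rw [Mesh.mem_cell_iff]
        push_cast
        exact ⟨hzre, by linarith, by linarith⟩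
      · exfalso
        refine hzγ (hseg ?_)
        rw [segment_eq_image']
        refine ⟨(z.re - δ * u 0) / δ, ⟨div_nonneg (by linarith) hδ.le, ?_⟩,
          Complex.ext ?_ ?_⟩
        · rw [div_le_one hδ]; linarith
        · simp only [Complex.add_re, Complex.smul_re, Complex.sub_re, meshPoint_re, h0,
            smul_eq_mul]; field_simp; ring
        · simp only [Complex.add_im, Complex.smul_im, Complex.sub_im, meshPoint_im, h1,
            smul_eq_mul, heq]; ring
      · left
        rw [Mesh.mem_cell_iff]
        exact ⟨hzre, hgt, by linarith⟩
    rcases cell_subset_inside_or hδ hγ hgrid hmseg hWo hmW _ _ _ _ hWPP with h | h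
    · exact ⟨u, fun k => Or.inl rfl, fun k => by fin_cases k <;> simp, h⟩
    · refine ⟨![u 0, u 1 - 1], fun k => by fin_cases k <;> simp,
        fun k => by fin_cases k <;> simp, ?_⟩
      simpa using h
  · -- vertical edge `u → u + e₁`: the cells `(u 0, u 1)` right and `(u 0 - 1, u 1)` left
    have h0 : (((u + Pi.single (1 : Fin 2) (1 : ℤ) : Site 2) 0 : ℤ) : ℝ) = u 0 := by simp
    have h1 : (((u + Pi.single (1 : Fin 2) (1 : ℤ) : Site 2) 1 : ℤ) : ℝ) = u 1 + 1 := by simp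
    set m : ℂ := ⟨δ * u 0, δ * (u 1 + 1 / 2)⟩ with hm
    have hmseg : m ∈ range γ := by
      refine hseg ?_
      rw [segment_eq_image']
      refine ⟨1 / 2, ⟨by norm_num, by norm_num⟩, Complex.ext ?_ ?_⟩
      · simp only [Complex.add_re, Complex.smul_re, Complex.sub_re, meshPoint_re, h0,
          smul_eq_mul, hm]; ring
      · simp only [Complex.add_im, Complex.smul_im, Complex.sub_im, meshPoint_im, h1,
          smul_eq_mul, hm]; ring
    set W : Set ℂ := Ioo (δ * (u 0 - 1)) (δ * (u 0 + 1)) ×ℂ Ioo (δ * u 1) (δ * (u 1 + 1))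
      with hW
    have hWo : IsOpen W := isOpen_Ioo.reProdIm isOpen_Ioo
    have hmW : m ∈ W := by
      simp only [hW, Complex.mem_reProdIm, mem_Ioo, hm]
      refine ⟨⟨?_, ?_⟩, ?_, ?_⟩ <;> nlinarith
    have hWPP : W \ range γ ⊆ Mesh.cell δ (u 0) (u 1) ∪ Mesh.cell δ (u 0 - 1) (u 1) := by
      rintro z ⟨⟨hzre, hzim⟩, hzγ⟩
      simp only [mem_preimage, mem_Ioo] at hzre hzim
      rcases lt_trichotomy z.re (δ * u 0) with hlt | heq | hgt
      · right
        rw [Mesh.mem_cell_iff]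
        push_cast
        exact ⟨⟨by linarith, by linarith⟩, hzim⟩
      · exfalso
        refine hzγ (hseg ?_)
        rw [segment_eq_image']
        refine ⟨(z.im - δ * u 1) / δ, ⟨div_nonneg (by linarith [hzim.1]) hδ.le, ?_⟩,
          Complex.ext ?_ ?_⟩
        · rw [div_le_one hδ]; linarith [hzim.2]
        · simp only [Complex.add_re, Complex.smul_re, Complex.sub_re, meshPoint_re, h0,
            smul_eq_mul, heq]; ring
        · simp only [Complex.add_im, Complex.smul_im, Complex.sub_im, meshPoint_im, h1,
            smul_eq_mul]; field_simp; ring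
      · left
        rw [Mesh.mem_cell_iff]
        exact ⟨⟨hgt, by linarith [hzre.2]⟩, hzim⟩
    rcases cell_subset_inside_or hδ hγ hgrid hmseg hWo hmW _ _ _ _ hWPP with h | h
    · exact ⟨u, fun k => Or.inl rfl, fun k => by fin_cases k <;> simp, h⟩
    · refine ⟨![u 0 - 1, u 1], fun k => by fin_cases k <;> simp,
        fun k => by fin_cases k <;> simp, ?_⟩
      simpa using h

/-! ## The free-cell / bridge dichotomy -/

/-- **Oriented core of `quadCarrier_cell_or_bridge`.**  If the drawn edge from `u` to
`u' = u + eᵢ` lies in `[Q]` and some lattice walk from `u` to `u'` drawn inside `[Q]` avoids the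
edge `{u, u'}`, then one of the two closed mesh cells beside the edge lies in `[Q]`. -/
theorem exists_cell_subset_carrier_of_detour (hδ : 0 < δ) (Q : Quad D) {u u' : Site 2}
    {i : Fin 2} (hu' : u' = u + Pi.single i 1)
    (hseg : segment ℝ (meshPoint δ u) (meshPoint δ u') ⊆ Q.carrier)
    (p : (zdGraph 2).Walk u u') (hp : openEdgeUnion δ {e | e ∈ p.edges} ⊆ Q.carrier)
    (he : s(u, u') ∉ p.edges) :
    ∃ c : Site 2, (∀ k, u k = c k ∨ u k = c k + 1) ∧ (∀ k, u' k = c k ∨ u' k = c k + 1) ∧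
      Set.Icc (δ * c 0) (δ * (c 0 + 1)) ×ℂ Set.Icc (δ * c 1) (δ * (c 1 + 1)) ⊆ Q.carrier := by
  have hadj0 : (zdGraph 2).Adj u u' := (zdGraph_adj_iff u u').2 ⟨i, Or.inl hu'⟩
  have hqpath : p.bypass.IsPath := p.bypass_isPath
  have hqe : s(u, u') ∉ p.bypass.edges := fun h => he (p.edges_bypass_subset_edges h)
  have hqQ : openEdgeUnion δ {e | e ∈ p.bypass.edges} ⊆ Q.carrier :=
    (openEdgeUnion_mono δ (show {e | e ∈ p.bypass.edges} ⊆ {e | e ∈ p.edges} from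
      fun e he => p.edges_bypass_subset_edges he)).trans hp
  set q := p.bypass with hq
  have hedge : ∀ k < q.length, s(q.getVert k, q.getVert (k + 1)) ∈ q.edges := fun k hk => by
    have hk' : k < q.darts.length := by rwa [SimpleGraph.Walk.length_darts]
    have hmem := List.getElem_mem hk'
    rw [SimpleGraph.Walk.darts_getElem_eq_getVert k hk'] at hmem
    exact List.mem_map.2 ⟨_, hmem, rfl⟩
  -- the detour has at least two edges
  have hlen2 : 2 ≤ q.length := by
    by_contra hlt
    rcases Nat.lt_or_ge 0 q.length with hpos | hzero
    · have h01 := hedge 0 hpos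
      rw [q.getVert_zero, q.getVert_of_length_le (by omega)] at h01
      exact hqe h01
    · exact hadj0.ne (by simpa using q.getVert_of_length_le (i := 0) (by omega))
  -- the cycle: `q` closed up by the edge `u' u`
  set N := q.length + 1 with hN
  have hN3 : 3 ≤ N := by omega
  have hcyc : ∀ k < N, (zdGraph 2).Adj (q.getVert k) (q.getVert ((k + 1) % N)) := by
    intro k hk
    rcases Nat.lt_or_ge (k + 1) N with hlt | hge
    · rw [Nat.mod_eq_of_lt hlt]
      exact q.adj_getVert_succ (by omega)
    · have hmod : (k + 1) % N = 0 := by rw [show k + 1 = N by omega, Nat.mod_self]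
      rw [hmod, show k = q.length by omega, q.getVert_length, q.getVert_zero]
      exact hadj0.symm
  have hinj : Set.InjOn q.getVert (Set.Iio N) := fun a ha b hb h =>
    hqpath.getVert_injOn (Nat.lt_succ_iff.1 ha) (Nat.lt_succ_iff.1 hb) h
  obtain ⟨γ, hγ, hrange⟩ := exists_isJordanLoop_latticeCycle hδ hN3 hcyc hinj
  -- the loop runs in `[Q]`, on the grid lines, and along the edge `u u'`
  have hγQ : range γ ⊆ Q.carrier := by
    intro z hz
    obtain ⟨k, hk, hzk⟩ := (hrange z).1 hz
    rcases Nat.lt_or_ge (k + 1) N with hlt | hge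
    · rw [Nat.mod_eq_of_lt hlt] at hzk
      exact hqQ (mem_openEdgeUnion_iff.2
        ⟨_, _, q.adj_getVert_succ (by omega), hedge k (by omega), hzk⟩)
    · have hmod : (k + 1) % N = 0 := by rw [show k + 1 = N by omega, Nat.mod_self]
      rw [hmod, show k = q.length by omega, q.getVert_length, q.getVert_zero, segment_symm] at hzk
      exact hseg hzk
  have hγgrid : range γ ⊆ Mesh.gridLines δ := by
    intro z hz
    obtain ⟨k, hk, hzk⟩ := (hrange z).1 hz
    exact Mesh.segment_meshPoint_subset_gridLines δ (hcyc k hk) hzk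
  have hsegγ : segment ℝ (meshPoint δ u) (meshPoint δ u') ⊆ range γ := by
    intro z hz
    refine (hrange z).2 ⟨q.length, by omega, ?_⟩
    rw [hN, Nat.mod_self, q.getVert_length, q.getVert_zero, segment_symm]
    exact hz
  -- an adjacent open cell is inside the loop; its closure lies in `[Q]`
  subst hu'
  obtain ⟨c, hcu, hcu', hcell⟩ := exists_cell_subset_inside hδ hγ hγgrid u i hsegγ
  refine ⟨c, hcu, hcu', ?_⟩
  rw [← Mesh.closure_cell hδ]
  exact (closure_mono hcell).trans (closure_inside_subset_carrier hγ Q hγQ)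

/-- **Free-cell / bridge dichotomy** (brick (S1) of the boundary-layer surgery
`stub_layerLocalModification`; registered helper).  Let `Q` be a quad and `{u, u'}` a lattice
edge of `ℤ²` whose drawn closed segment at mesh `δ > 0` lies in the closed carrier `[Q]`.
Then EITHER one of the two closed unit mesh cells beside the edge (lower-left corner `δc`, both
`u` and `u'` corners of the cell) lies in `[Q]`, OR the edge is a bridge of the graph of lattice
edges drawn inside `[Q]`: every lattice walk from `u` to `u'` whose drawn edges lie in `[Q]`
traverses `{u, u'}`. -/
theorem quadCarrier_cell_or_bridge : ∀ (D : Set ℂ) (δ : ℝ), 0 < δ → ∀ (Q : Quad D) (u u' : Site 2), (zdGraph 2).Adj u u' → segment ℝ (meshPoint δ u) (meshPoint δ u') ⊆ Q.carrier → (∃ c : Site 2, (∀ k, u k = c k ∨ u k = c k + 1) ∧ (∀ k, u' k = c k ∨ u' k = c k + 1) ∧ Set.Icc (δ * c 0) (δ * (c 0 + 1)) ×ℂ Set.Icc (δ * c 1) (δ * (c 1 + 1)) ⊆ Q.carrier) ∨ ∀ p : (zdGraph 2).Walk u u', openEdgeUnion δ {e | e ∈ p.edges} ⊆ Q.carrier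 → s(u, u') ∈ p.edges := by
  intro D δ hδ Q u u' huu' hseg
  rw [or_iff_not_imp_right]
  intro hnb
  push Not at hnb
  obtain ⟨p, hp, hpe⟩ := hnb
  obtain ⟨i, hi | hi⟩ := (zdGraph_adj_iff u u').1 huu'
  · exact exists_cell_subset_carrier_of_detour hδ Q hi hseg p hp hpe
  · have hset : {e | e ∈ p.reverse.edges} = {e | e ∈ p.edges} :=
      Set.ext fun e => by simp [SimpleGraph.Walk.edges_reverse]
    obtain ⟨c, h1, h2, h3⟩ := exists_cell_subset_carrier_of_detour hδ Q hi
      (by rwa [segment_symm]) p.reverse (by rw [hset]; exact hp)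
      (by rw [SimpleGraph.Walk.edges_reverse, List.mem_reverse, Sym2.eq_swap]; exact hpe)
    exact ⟨c, h2, h1, h3⟩

end Summit.CriticalPhenomena.CardyFormulaZ2.Theorems.CardySelfRefinement

end
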